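import Summits.ResolutionOfSingularities.ResolutionOfSingularities.Theorems.PurelyInseparableDim4ResConeHeavyKeepStepLetters
import Summits.ResolutionOfSingularities.ResolutionOfSingularities.Theorems.PurelyInseparableDim4ResConePermanentConeLetter
import Summits.ResolutionOfSingularities.ResolutionOfSingularities.Theorems.PurelyInseparableDim4ResConeActiveThreshold
import Summits.ResolutionOfSingularities.ResolutionOfSingularities.Theorems.PurelyInseparableDim4ResConeHeavyPermanentSet
import HarnessLib
import HarnessLib.Audit.Tags

/-!
# Purely inseparable four-folds — THE KEEP LAW WITH A FROZEN CONE MONOMIAL, in the exact shape `hK` of the holder's assembly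
# `no_binaryCone_tail_of_keepLaw` (K2(p) lane, rung-2 row E-CONE; cell `res-dim4-pi`)

[OURS · counted 0 · cell `res-dim4-pi` · K2(p) lane holder res-dim4-p-12 g5 (statement layer 2026-08-29 10:42:31Z: «the EXACT hypothesis
`hK` your file must discharge»); seat res-dim4-p-7 g5 (K_set).]  Nothing here proves any TAIL(p, d, e), K2(7), K2(p) or resolution of
singularities in dimension ≥ 4 / characteristic `p` — NOT proved.  AI kernel work, weaker than expert review.

**`keepLaw_frozenCone`** turns K_set's chain dress `tail_heavy_keep_step_letters` (`…HeavyKeepStepLetters`) into the holder's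
hypothesis VERBATIM: for every set `P` PERMANENT from `M ≥ k₀` with weights `≥ 1` (`∀ z ∈ P, ∀ m ≥ M, 1 ≤ r_m z ∧ z ≠ j m ∧ b m z = 0`),
every `k ≥ M`, every active letter `h ∉ P` with `p ≤ r_k h + Σ_{z∈P} r_M z + d` KEPT by the step (`j k ≠ h`, `b k h = 0`), a run frame at `k`
with `u₁ = e_h` and `0 < αs` passes to a run frame at `k + 1` with `u₁ = e_h`, `0 < αs′` and `βs′ < βs`.  The three side facts are
derived inside: the letters of `P` are CONE letters at `k` (res-dim4-p-9 g5's `permanentSet_coneLetters`, `…PermanentConeLetter`); the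
frozen sum `Σ_{z∈P} r_k z = Σ_{z∈P} r_M z` (res-dim4-p-5 g5's `sum_frozen_of_permanent`, `…ActiveThreshold`); and the numerology of `h`:
`r_k h < p` by isolation ((K-Φ1)-T at exponent `0` in the given frame) and `0 < r_k h` because otherwise `p ≤ W + d` and the frozen set
alone is heavy — res-dim4-p-5 g5's `no_tail_of_permanent_weight_ge` (`…HeavyPermanentSet`).  The set exponent is `m := p − r_k h − W`
when `r_k h + W < p`, else `m := 1` (`1 ≤ d`).
[cite: CossartJannsenSaito2020, Lemma 11.5, Lemma 12.2 (5), Lemma 13.4 (3), Thm. 3.14] [cite: CossartPiltant2008, (16)]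
bears_on: LADDER-RESOLUTION:D157-DOOR2 (res-dim4-pi · K2(p) · rung-2 row E-CONE · K_set in the assembly's shape).  Supports
stmt-ResolutionOfSingularities-16155 (helper).
-/

set_option linter.dupNamespace false -- mandated namespace of this single-conjunct summit

noncomputable section

namespace Summit.ResolutionOfSingularities.ResolutionOfSingularities.Theorems.PIDim4

namespace ResCone

open MvPolynomial Finset IsLocalRing
open Literature.AlgebraicGeometry.Resolution
open Literature.AlgebraicGeometry.Resolution.CentreBlowup
open Literature.AlgebraicGeometry.Resolution.Hauser2010
open Literature.AlgebraicGeometry.Resolution.HauserPerlega2019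
open Literature.AlgebraicGeometry.Resolution.WeightedOrder
open PointBlowup (direction additiveSubspace)

variable {K : Type} [Field K]

section KeepLaw

variable (p : ℕ) [hp : Fact p.Prime] [CharP K p] [DecidableEq K]

/-- **THE KEEP LAW WITH A FROZEN CONE MONOMIAL** — hypothesis `hK` of the holder's `no_binaryCone_tail_of_keepLaw`, discharged.
Along a witnessed isolated above-floor `Step0 p` chain with `x^{r₀} ∣ F₀`, constant shade `1 ≤ d < p` and `e_G = 2` from `k₀`: for every
set `P` permanent from `M ≥ k₀` with weights `≥ 1`, every `k ≥ M` and every letter `h ∉ P` with `p ≤ r_k h + Σ_{z∈P} r_M z + d` kept by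
the step (`j k ≠ h`, `b k h = 0`), a RUN frame at `k` (`u₁ = e_h`, y-rows ⟂ `resVertex (c k)`, `pts ≠ ∅`, `d! < δs`, `0 < αs` for `(G_k)`,
`G_k = F_k / x^{r_k}`) yields a RUN frame at `k + 1` (`u₁′ = e_h`, y′-rows ⟂ `resVertex (c (k+1))`, `pts′ ≠ ∅`, `d! < δs′`), `0 < αs′`,
**`βs′ < βs`** — by `tail_heavy_keep_step_letters` with the cone-ness of `P`, the frozen sum and the numerology of `h` derived inside
(see the module docstring). [OURS] [cite: CossartJannsenSaito2020, Lemma 12.2 (5), Lemma 13.4 (3), Thm. 3.14]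
[cite: CossartPiltant2008, (16)] -/
theorem keepLaw_frozenCone {c : ℕ → State K} {j : ℕ → Fin 4} {b : ℕ → Fin 4 → K}
    (hc : ∀ k, IsIsolated p (c k).F ∧ Step0 p (c k) (c (k + 1))) (hw : FreeTail.IsWitnessedChain p c j b)
    (hr0 : ∀ e ∈ (c 0).F.support, (c 0).r ≤ e) (hfloor : ∀ k, ordZero (c k).F ≠ p) {k₀ d : ℕ} (hd : 1 ≤ d) (hdp : d < p)
    (hshade : ∀ k, k₀ ≤ k → (c k).shade = (d : ℕ∞))
    (he : ∀ k, k₀ ≤ k → Module.finrank K (resVertex (c k)) = 2) :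
    ∀ (M : ℕ) (P : Finset (Fin 4)), k₀ ≤ M →
      (∀ z ∈ P, ∀ m, M ≤ m → 1 ≤ (c m).r z ∧ z ≠ j m ∧ b m z = 0) →
      ∀ k, M ≤ k → ∀ (h : Fin 4), h ∉ P → p ≤ (c k).r h + (∑ z ∈ P, (c M).r z) + d → j k ≠ h → b k h = 0 →
      ∀ (L : Fin (2 + 2) → Fin 4 → K) (Mx : Fin 4 → Fin (2 + 2) → K),
        (∀ t u, ∑ i, Mx t i * L i u = if t = u then 1 else 0) → L (u1 2) = Pi.single h 1 →
        (∀ i, i ≠ u1 2 → i ≠ u2 2 → ∀ w ∈ resVertex (c k), ∑ t, L i t * w t = 0) →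
        (pts (fun i => algebraMap (MvPolynomial (Fin 4) K) (OriginLocalization K 4) (∑ t, C (L i t) * X t))
          (Ideal.span {algebraMap (MvPolynomial (Fin 4) K) (OriginLocalization K 4)
            ((c k).F.divMonomial (c k).r)}) d).Nonempty →
        Nat.factorial d < deltaS (fun i => algebraMap (MvPolynomial (Fin 4) K) (OriginLocalization K 4) (∑ t, C (L i t) * X t))
          (Ideal.span {algebraMap (MvPolynomial (Fin 4) K) (OriginLocalization K 4)
            ((c k).F.divMonomial (c k).r)}) d →
        0 < alphaS (fun i => algebraMap (MvPolynomial (Fin 4) K) (OriginLocalization K 4) (∑ t, C (L i t) * X t))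
          (Ideal.span {algebraMap (MvPolynomial (Fin 4) K) (OriginLocalization K 4)
            ((c k).F.divMonomial (c k).r)}) d →
        ∃ (L' : Fin (2 + 2) → Fin 4 → K) (M' : Fin 4 → Fin (2 + 2) → K),
          ((∀ t u, ∑ i, M' t i * L' i u = if t = u then 1 else 0) ∧ L' (u1 2) = Pi.single h 1 ∧
            (∀ i, i ≠ u1 2 → i ≠ u2 2 → ∀ w ∈ resVertex (c (k + 1)), ∑ t, L' i t * w t = 0) ∧
            (pts (fun i => algebraMap (MvPolynomial (Fin 4) K) (OriginLocalization K 4) (∑ t, C (L' i t) * X t))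
              (Ideal.span {algebraMap (MvPolynomial (Fin 4) K) (OriginLocalization K 4)
                ((c (k + 1)).F.divMonomial (c (k + 1)).r)}) d).Nonempty ∧
            Nat.factorial d < deltaS (fun i => algebraMap (MvPolynomial (Fin 4) K) (OriginLocalization K 4)
              (∑ t, C (L' i t) * X t)) (Ideal.span {algebraMap (MvPolynomial (Fin 4) K) (OriginLocalization K 4)
                ((c (k + 1)).F.divMonomial (c (k + 1)).r)}) d) ∧
          0 < alphaS (fun i => algebraMap (MvPolynomial (Fin 4) K) (OriginLocalization K 4) (∑ t, C (L' i t) * X t))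
            (Ideal.span {algebraMap (MvPolynomial (Fin 4) K) (OriginLocalization K 4)
              ((c (k + 1)).F.divMonomial (c (k + 1)).r)}) d ∧
          betaS (fun i => algebraMap (MvPolynomial (Fin 4) K) (OriginLocalization K 4) (∑ t, C (L' i t) * X t))
              (Ideal.span {algebraMap (MvPolynomial (Fin 4) K) (OriginLocalization K 4)
                ((c (k + 1)).F.divMonomial (c (k + 1)).r)}) d <
            betaS (fun i => algebraMap (MvPolynomial (Fin 4) K) (OriginLocalization K 4) (∑ t, C (L i t) * X t))
              (Ideal.span {algebraMap (MvPolynomial (Fin 4) K) (OriginLocalization K 4)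
                ((c k).F.divMonomial (c k).r)}) d := by
  intro M P hM hperm k hk h hhP hthr hjh hbh L Mx hMx hLu1 hy hne hδ hα0
  have hk₀ : k₀ ≤ k := le_trans hM hk
  have hperm' : ∀ z ∈ P, ∀ m, M ≤ m → z ≠ j m ∧ b m z = 0 := fun z hz m hm => (hperm z hz m hm).2
  -- the frozen sum, read at `k`
  have hW : ∑ z ∈ P, (c k).r z = ∑ z ∈ P, (c M).r z := sum_frozen_of_permanent p hc hw hfloor hperm' hk
  -- the letters of `P` are cone letters at `k`
  have hPcone : ∀ z ∈ P, ∀ v ∈ resVertex (c k), v z = 0 := fun z hz =>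
    permanentSet_coneLetters hc hw hr0 hfloor hshade he hM
      (fun z hz m hm => ⟨(hperm' z hz m hm).1.symm, (hperm' z hz m hm).2⟩) z hz k hk
  -- `r_k h < p` by isolation: (K-Φ1)-T at exponent `0` in the given frame
  obtain ⟨hF, -, -, -, -⟩ := tail_factorisation hc hr0 hfloor hshade hk₀
  have hgen := span_range_frame_eq_maximalIdeal L Mx hMx
  have hrp : (c k).r h < p := by
    by_contra hge
    push Not at hge
    have hmem := PhiLine.not_mem_primePow_loc_of_isIsolated_letters (n := 0) hF (hc k).1 {h}
      (by rw [Finset.sum_singleton]; omega) (PhiLine.isPrime_yu1Ideal _ hgen) (PhiLine.yu1Ideal_ne_maximalIdeal _ hgen)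
      (fun i hi => by
        rw [Finset.mem_singleton] at hi
        rw [hi]
        exact PhiLine.algebraMap_X_mem_yu1Ideal_of_eq (by simp only [hLu1, PhiLine.sum_C_single_mul_X]))
    exact hmem (by rw [pow_zero, Ideal.one_eq_top]; exact Submodule.mem_top)
  -- `0 < r_k h`: otherwise `p ≤ W + d` and the frozen set alone is heavy — no such tail
  have hh0 : 0 < (c k).r h := by
    by_contra h0
    push Not at h0
    exact no_tail_of_permanent_weight_ge p hc hw hr0 hfloor hshade hM hperm' (by omega)
  -- the set exponent `m`
  obtain ⟨m, hm1, hmd, hmh, hcrit⟩ : ∃ m, 1 ≤ m ∧ m ≤ d ∧ (c k).r h + m ≤ p ∧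
      p ≤ (∑ i ∈ insert h P, (c k).r i) + m := by
    rw [Finset.sum_insert hhP, hW]
    by_cases hlt : (c k).r h + ∑ z ∈ P, (c M).r z < p
    · exact ⟨p - (c k).r h - ∑ z ∈ P, (c M).r z, by omega, by omega, by omega, by omega⟩
    · exact ⟨1, le_rfl, hd, by omega, by omega⟩
  obtain ⟨L', M', ⟨h1, h2, h3, h4, h5, -⟩, hpos, hlt⟩ := tail_heavy_keep_step_letters hdp hm1 hmd hc hw hr0 hfloor hshade he
    hk₀ hh0 hjh hbh P hPcone hcrit hmh hMx hLu1 hy hne hδ hα0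
  exact ⟨L', M', ⟨h1, h2, h3, h4, h5⟩, hpos, hlt⟩

end KeepLaw

end ResCone

end Summit.ResolutionOfSingularities.ResolutionOfSingularities.Theorems.PIDim4

end
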